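import Literature.NumberTheory.LFunctions.Zhang2022.DHCertificate
import Literature.NumberTheory.LFunctions.LOneLargeValuesPrimeModulus

/-!
# Zhang (2022), rung F-S3, family B-dh — E-18d: the value-field companion `MenuInformalLOneConsistent`
# (dhE-18 (ii), Granville–Soundararajan 2006 §7 Theorem 3 (ii), rendered over the world `W⁺ = W` with a value profile)

Y. Zhang, *Discrete mean estimates and the Landau–Siegel zero*, arXiv:2211.02515v1 [Zhang2022LandauSiegel] — an unrefereed
manuscript under adjudication. **The programme SEARCHES and TYPES; no claim about Landau–Siegel zeros, Theorems 1–2 of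
arXiv:2211.02515 or a repaired Margin232 until a kernel theorem says so.** Nothing in this file is a statement about a
Dirichlet `L`-function: `DH.worldPlus D χ` below is abstract zero/value/prime-count DATA (the cell's consistency world
`DH.world D χ` of `DHChainBarrier`, p461081/p461386, with ONE field changed) and every theorem is elementary bookkeeping about
that data. Cell `landau-siegel` (pub/landau-siegel/), sub-cells B-dh / E; written by ls-Bdh-typer-1 g3 (offer on the cell
bus, GO = ls-Bdh-plan g2 2026-08-27T00:43:36Z «E-18d, pre-emptible idle filler», conditions (i)–(v) there; no REF-E read
required — a companion outside the word).

## What this companion is, and what it is not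

The B-dh word of record «KILL(B-dh) inside Σ_menu» is UNCONDITIONAL over `M_typed ∪ M_primes` (`DH.certificate_holds`
p478764, conjuncts 1–2); the typed rows of `M_informal` carry COMPANIONS over the SAME world (conjuncts 3–4: dhE-07, dhE-28,
BGTZ Cor 1.2, Kadiri ∃R₀, and the dhE-14 critical-line proportions). ONE typed `M_informal` row was left without a companion
"by inspection" (B-dh/EDLIST.md v1.6.1 row dhE-18; BARRIER-STATE §2′ N8): **dhE-18 (ii) = E-051 =
`granvilleSoundararajan2006_theorem3ii`** (`LOneLargeValuesPrimeModulus.lean`, ls-Bdh-typer-2 g3, p478408): «there is `C`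
such that for every `A ≥ 10` there is `q₀` with `q^{1−1/A} ≤ #{χ (mod q) : χ ≠ χ₀, |L(1,χ)| ≥ e^γ(log₂q + log₃q − log₄q −
log A − C)}` for every prime `q ≥ q₀`» [cite: GranvilleSoundararajan2006ExtremeValues, §7 Theorem 3 (ii) p.6]. The reason was
that `W`'s value field is `LOne ∈ {λ, 1}` (`DHChainBarrier` :279) — a CHOICE, not a constraint: the world structure
`ZeroWorld` CARRIES a value field `LOne` (read by the rows (A), 09, 11, 12, 15, 19, S3 of `Menu`), and B-dh/KILL-draft.md
v1.4.5 §2 P6 / §3 names the fallback «ψ-dependent value profile `v₀(q) := e^γ(log log q + log log log q)`» for exactly the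
case «should a value-distribution row (dhE-18(ii) …) ever be instantiated».

THIS FILE instantiates it: `worldPlus D χ` **= `world D χ` in every field except `LOne`**, where
`LOne q ψ := λ(D)` on the induced ("exceptional") slots (as in `W`), `:= v₀(q)` on every other non-principal slot of a level
with `log q ≥ 24`, `:= 1` elsewhere; and proves, with ALL existential constants of ALL rows chosen ONCE before `∀ D`:

`MenuInformalLOneConsistent :` there are `C`, `q₀ : ℝ → ℕ` (dhE-18 (ii)), `C₇, c₀, C₂₈, C₁₂, R₀` (E-18c part 1) and
`Q₀, Q₁, T₀` (E-18c part 2) such that for every modulus `D` with `log D ≥ 43 250` and every primitive quadratic `χ ≠ χ₀`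
mod `D`: `(worldPlus D χ).Menu D χ ∧ PrimeMenu (worldPlus D χ) (primeWorld D χ) ∧ (worldPlus D χ).MenuInformal C₇ c₀ C₂₈ C₁₂ R₀
∧ (worldPlus D χ).MenuInformalCritLine Q₀ Q₁ T₀ ∧ (worldPlus D χ).MenuInformalLOne C q₀` — i.e. ONE world meets every
kernel-typed row of `M_typed ∪ M_primes ∪ M_informal` INCLUDING dhE-18 (ii) rendered VERBATIM (typer-2's
`GranvilleSoundararajan2006.largeValueLevel C A q` unchanged; `‖L(1,χ)‖ ↦ w.LOne q χ` in the counting function). The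
planner's minimal letter (GO (ii)) is `Menu ∧ row 18 (ii)` on the same `W⁺`; the three zero/prime-data menus are restated as
conjuncts because they come for free (transfer by `rfl`, §8) and make the sentence «one world for every typed row» literal.

PROOF MAP. Zero/prime-data rows (`Menu` rows 01–06, 08, 10, 13, S1, S2, S4; all of `PrimeMenu`, `MenuInformal`,
`MenuInformalCritLine`): `worldPlus` and `world` have the same `mult`, `Lhalf`, `psi` BY `rfl`, so the landed theorems
(`menuConsistent_holds` p468827, `menuConsistentPrimes_holds` p473947, `menuInformalConsistent_holds` p475376,
`menuInformalCritLineConsistent_holds` p476879) transfer field by field by definitional unfolding. Value rows, re-proved on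
`W⁺`: (A) and row 12 read the slot `(D, χ)` (induced: `λ`); row 09 reads a quadratic slot with a real zero in the window
`(1 − 1/(10 log q), 1)` — such a zero is `β₁` on an induced slot (`real_zero_gt_half`), value `λ`, so BGTZ Lemma 2.9's
bracket holds as on `W`; row 11 (`≤ log q`, `ψ ≠ χ₀`): `λ ≤ 1 < log q`, `1 < log 3 ≤ log q`, and **`v₀(q) ≤ log q` for
`log q ≥ 24`** (`e^γ < e^{2/3} < 2`, `log log x ≤ log x − 1`, `4 log x ≤ x` for `x ≥ 24`); row 15 (`≥ 0.69/√q`, real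
primitive): induced slots as on `W`, `v₀(q) ≥ 1` (`γ > ½`, `log log q ≥ 1` for `log q ≥ 24 ≥ e^e`), `1 ≥ 0.69/√q`; row 19
(GRH-conditional LLS caps): INERT on `W⁺` as on `W` (`β₁ > ½` is a zero); S3: `v₀ > 0`, and the profile predicate is
invariant under `ψ ↦ ψ⁻¹` (`isExcSlot_inv_iff`, `inv_eq_one`). dhE-18 (ii) on `W⁺` with `C := 0`,
`q₀(A) := row18Threshold A := ⌈exp(max A 24)⌉₊` (the level threshold is `24`, not the `20` of the offer line: `24` is what
the elementary route `4 log x ≤ x ⇐ 1 + y + y²/2 ≤ e^y`, `y = x/4 ≥ 6`, for row 11 needs; any larger constant would do):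
for prime `q ≥ q₀(A)` one has `log q ≥ 24` and `log q ≥ A`, so (1) the level
`e^γ(log₂q + log₃q − log₄q − log A − 0) ≤ v₀(q)` because `log₄q ≥ 0` (`log q ≥ 24 ≥ e^e`) and `log A ≥ log 10 > 0`; (2) every
non-principal non-induced `ψ` mod `q` is counted, and there are at least `(q − 1) − 1 − 1 = q − 3` of them (`φ(q) = q − 1`
characters, one principal, at most ONE induced slot per level by `IsExcSlot.eq_of_eq`); (3) `q^{1−1/A} = q/q^{1/A} ≤ q/e ≤
q/2 ≤ q − 3` since `q ≥ e^A` gives `q^{1/A} ≥ e`. No number in this file is load-bearing beyond these integer-sized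
inequalities; no certificate, no float.

SCOPE (verbatim status; this file moves no word): a COMPANION, OUTSIDE the word's scope exactly like E-18c (director term
(i); KILL-draft v1.4.5 §1 lists dhE-18(ii) in `M_informal`); it says that the typed numeric instance of dhE-18 (ii) is met,
together with every other kernel-typed row, by ONE explicit world, nothing more. Status of the row itself: theorem-in-print
with INEXPLICIT constants (`O(1)`, "`q` large"); its explicit-constant version is open in print (EDLIST dhE-18). NOT rendered,
by name: dhE-18 (i) (the distribution law (7.1) — a DISTRIBUTION row, context; KILL-draft §2 P6 «Rows EXCLUDED BY NAME»),
dhE-20 (Selberg 1946 CLT for `S(t,χ)` — context row, untyped), any mean-value row of `|L(1,χ)|` (none is typed in the menu;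
`W⁺`'s all-high profile would not meet a second-moment row — instantiating one re-opens the certificate, as the word says).
Design choice recorded: the profile sits on ALL non-principal non-induced slots of the large levels (not on one conjugate
pair as KILL-draft §2 P6 sketches) because Theorem 3 (ii) as PRINTED and as typed asks for `q^{1−1/A}` characters for EVERY
`A ≥ 10`, i.e. for almost all characters as `A → ∞`; no typed row caps the number of large values.

«The programme SEARCHES and TYPES; no claim about Landau–Siegel zeros, Theorems 1–2 of arXiv:2211.02515 or a repaired
Margin232 until a kernel theorem says so.»

## References

* [Zhang2022LandauSiegel] Y. Zhang, *Discrete mean estimates and the Landau–Siegel zero*, arXiv:2211.02515v1 (2022), §2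
  Assumption (A).
* [GranvilleSoundararajan2006ExtremeValues] A. Granville, K. Soundararajan, *Extreme values of `|ζ(1+it)|`*, Ramanujan Math.
  Soc. Lect. Notes Ser. 2 (2006) 65–80, arXiv:math/0501232 — §7 Theorem 3 (ii), read on `paper:arxiv-math_0501232`
  p0006:L130–L150 (typed statement: `LOneLargeValuesPrimeModulus.lean`, p478408).
* [BenliGoelTwissZaman2025] Lemma 2.9 (row 09); [MontgomeryVaughan2007] §4.3, §9.1 (rows 11, 15, S3; induced characters);
  [LamzouriLiSoundararajan2015] Thm 1.5 (row 19).
* pub/landau-siegel/B-dh/KILL-draft.md v1.4.5 §2 P6, §3 (the profile `v₀`); B-dh/EDLIST.md v1.6.1 row dhE-18;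
  barrier/BARRIER-STATE.md §2′ N8.
-/

noncomputable section

open scoped Classical
open Complex

namespace Literature.NumberTheory.LFunctions.Zhang2022.DH

/-! ## 1. Row dhE-18 (ii) over a world, and the informal value menu -/

namespace ZeroWorld

variable (w : ZeroWorld)

/-- The number of non-principal `ψ (mod q)` whose value datum is at least `V` over the world
(= `GranvilleSoundararajan2006.largeValueCount q V` with `‖L(1,ψ)‖ ↦ w.LOne q ψ`).
[cite: GranvilleSoundararajan2006ExtremeValues, §7 Theorem 3 (ii) p.6] -/
def largeValueCount (q : ℕ) [NeZero q] (V : ℝ) : ℕ :=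
  (Finset.univ.filter fun ψ : DirichletCharacter ℂ q => ψ ≠ 1 ∧ V ≤ w.LOne q ψ).card

/-- **THE INFORMAL VALUE MENU over a world**, constants as PARAMETERS (quantified ONCE, before `∀ D`, in
`MenuInformalLOneConsistent`): the one typed value-distribution row of `M_informal`, dhE-18 (ii) =
`granvilleSoundararajan2006_theorem3ii`, read verbatim on the world's value field (its `∃ C` is `C`; its `∃ q₀` after
`∀ A ≥ 10` is the Skolem function `q₀`). [cite: GranvilleSoundararajan2006ExtremeValues, §7 Theorem 3 (ii) p.6] -/
structure MenuInformalLOne (C : ℝ) (q₀ : ℝ → ℕ) : Prop where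
  /-- dhE-18 (ii) = `granvilleSoundararajan2006_theorem3ii` (level `GranvilleSoundararajan2006.largeValueLevel C A q` verbatim). -/
  row18ii : ∀ A : ℝ, 10 ≤ A → ∀ (q : ℕ) [NeZero q], q.Prime → q₀ A ≤ q →
    (q : ℝ) ^ (1 - 1 / A) ≤ (w.largeValueCount q (GranvilleSoundararajan2006.largeValueLevel C A q) : ℝ)

end ZeroWorld

/-! ## 2. The world `W⁺(D, χ)`: `W` with the KILL-draft §3 value profile -/

/-- The value profile `v₀(q) := e^γ (log log q + log log log q)` (KILL-draft v1.4.5 §2 P6 / §3).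
[cite: GranvilleSoundararajan2006ExtremeValues, §7 Theorem 3 (ii) p.6] -/
def valueProfile (q : ℕ) : ℝ :=
  Real.exp Real.eulerMascheroniConstant * (Real.log (Real.log q) + Real.log (Real.log (Real.log q)))

/-- **The world `W⁺(D, χ)`**: the (A)-world `world D χ` with the value field replaced by `λ(D)` on induced slots, `v₀(q)` on
the other non-principal slots of the levels `log q ≥ 24`, and `1` elsewhere; `mult`, `Lhalf`, `psi` unchanged.
[cite: Zhang2022LandauSiegel, §2 Assumption (A)] -/
def worldPlus (D : ℕ) (χ : DirichletCharacter ℂ D) : ZeroWorld :=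
  { world D χ with
    LOne := fun q ψ =>
      if IsExcSlot D χ q ψ then lam D else if ψ ≠ 1 ∧ (24 : ℝ) ≤ Real.log q then valueProfile q else 1 }

/-! ## 3. The certificate statement (E-18d) -/

/-- **`MenuInformalLOneConsistent` (B-DH-W⁺; companion E-18d).** There are constants — `C` and `q₀ : ℝ → ℕ` (dhE-18 (ii)),
`C₇ > 0`, `c₀, C₂₈` positive on `ε > 0`, `C₁₂`, `R₀ ≥ 1` (the typed ZD/ZFR rows of `M_informal`), `Q₀, Q₁, T₀` (the typed
critical-line rows) — chosen ONCE, such that for every modulus `D` with `log D ≥ 43 250` and every primitive quadratic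
`χ ≠ χ₀` mod `D` the world `worldPlus D χ` satisfies the typed menu `Menu`, the prime menu `PrimeMenu` (with `primeWorld D χ`),
the informal menus `MenuInformal`, `MenuInformalCritLine`, AND the value menu `MenuInformalLOne`: one world for every
kernel-typed row of `M_typed ∪ M_primes ∪ M_informal`. A COMPANION outside the word's scope (term (i)); untyped rows
(dhE-18 (i), dhE-20) stay outside. [cite: Zhang2022LandauSiegel, §2 Assumption (A)] -/
def MenuInformalLOneConsistent : Prop :=
  ∃ C : ℝ, ∃ q₀ : ℝ → ℕ,
  ∃ C₇ : ℝ, 0 < C₇ ∧ ∃ c₀ : ℝ → ℝ, (∀ ε : ℝ, 0 < ε → 0 < c₀ ε) ∧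
    ∃ C₂₈ : ℝ → ℝ, (∀ ε : ℝ, 0 < ε → 0 < C₂₈ ε) ∧ ∃ C₁₂ : ℝ → ℝ, ∃ R₀ : ℝ, 1 ≤ R₀ ∧
  ∃ Q₀ Q₁ : (ℝ → ℝ) → ℝ → ℝ, ∃ T₀ : (ℝ → ℝ) → ℝ,
    ∀ (D : ℕ) [NeZero D] (χ : DirichletCharacter ℂ D), χ.IsPrimitive → χ.IsQuadratic → χ ≠ 1 →
      (43250 : ℝ) ≤ Real.log D →
        (worldPlus D χ).Menu D χ ∧ PrimeMenu (worldPlus D χ) (primeWorld D χ) ∧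
          (worldPlus D χ).MenuInformal C₇ c₀ C₂₈ C₁₂ R₀ ∧ (worldPlus D χ).MenuInformalCritLine Q₀ Q₁ T₀ ∧
            (worldPlus D χ).MenuInformalLOne C q₀

/-! ## 4. `W⁺` and `W` share the zero, half-line and prime data -/

section Data

variable {D : ℕ} {χ : DirichletCharacter ℂ D}

/-- Same multiplicities. [cite: Zhang2022LandauSiegel, §2 Assumption (A)] -/
theorem worldPlus_mult : (worldPlus D χ).mult = (world D χ).mult := rfl

/-- Same half-line data. [cite: Zhang2022LandauSiegel, §2 Assumption (A)] -/
theorem worldPlus_Lhalf : (worldPlus D χ).Lhalf = (world D χ).Lhalf := rfl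

/-- Same prime-count data. [cite: Zhang2022LandauSiegel, §2 Assumption (A)] -/
theorem worldPlus_psi : (worldPlus D χ).psi = (world D χ).psi := rfl

/-- The value field of `W⁺`. [cite: Zhang2022LandauSiegel, §2 Assumption (A)] -/
theorem worldPlus_LOne (q : ℕ) (ψ : DirichletCharacter ℂ q) :
    (worldPlus D χ).LOne q ψ =
      if IsExcSlot D χ q ψ then lam D else if ψ ≠ 1 ∧ (24 : ℝ) ≤ Real.log q then valueProfile q else 1 := rfl

/-- Same zeros. [cite: Zhang2022LandauSiegel, §2 Assumption (A)] -/
theorem isZero_worldPlus_iff {q : ℕ} {ψ : DirichletCharacter ℂ q} {ρ : ℂ} :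
    (worldPlus D χ).IsZero q ψ ρ ↔ (world D χ).IsZero q ψ ρ := Iff.rfl

end Data

/-! ## 5. Numerics of the profile at `log q ≥ 24` -/

section Profile

/-- `e^3 < 21`. [folklore] -/
private theorem exp_three_lt : Real.exp 3 < 21 := by
  have h : Real.exp 3 = Real.exp 1 ^ 3 := by rw [← Real.exp_nat_mul]; norm_num
  rw [h]
  calc Real.exp 1 ^ 3 < (2.7182818286 : ℝ) ^ 3 :=
        pow_lt_pow_left₀ Real.exp_one_lt_d9 (Real.exp_pos 1).le (by norm_num)
    _ < 21 := by norm_num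

/-- `e^e ≤ 24`. [folklore] -/
private theorem exp_exp_one_le : Real.exp (Real.exp 1) ≤ 24 := by
  have h1 : Real.exp 1 < 3 := lt_trans Real.exp_one_lt_d9 (by norm_num)
  have h2 : Real.exp (Real.exp 1) ≤ Real.exp 3 := Real.exp_le_exp.mpr h1.le
  linarith [exp_three_lt]

/-- `1 < e^γ < 2`. [folklore] -/
private theorem exp_gamma_bounds :
    1 < Real.exp Real.eulerMascheroniConstant ∧ Real.exp Real.eulerMascheroniConstant < 2 := by
  constructor
  · exact Real.one_lt_exp_iff.mpr (lt_trans one_half_pos Real.one_half_lt_eulerMascheroniConstant)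
  · have h23 : Real.eulerMascheroniConstant < 2 / 3 := Real.eulerMascheroniConstant_lt_two_thirds
    have hlog2 : (2 : ℝ) / 3 < Real.log 2 := lt_trans (by norm_num) Real.log_two_gt_d9
    calc Real.exp Real.eulerMascheroniConstant < Real.exp (Real.log 2) := Real.exp_lt_exp.mpr (by linarith)
      _ = 2 := Real.exp_log (by norm_num)

variable {x : ℝ} (hx : 24 ≤ x)
include hx

/-- `log x ≥ e` for `x ≥ 24` (at `x = log q`: `log₂ q ≥ e`). [folklore] -/
private theorem exp_one_le_log : Real.exp 1 ≤ Real.log x := by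
  rw [Real.le_log_iff_exp_le (by linarith)]
  exact le_trans exp_exp_one_le hx

/-- `log x ≥ 1` for `x ≥ 24`. [folklore] -/
private theorem one_le_log : 1 ≤ Real.log x :=
  le_trans (by linarith [Real.exp_one_gt_d9]) (exp_one_le_log hx)

/-- `log log x ≥ 1` for `x ≥ 24` (at `x = log q`: `log₃ q ≥ 1`). [folklore] -/
private theorem one_le_log_log : 1 ≤ Real.log (Real.log x) := by
  rw [Real.le_log_iff_exp_le (lt_of_lt_of_le (Real.exp_pos 1) (exp_one_le_log hx))]
  exact exp_one_le_log hx

/-- `log log log x ≥ 0` for `x ≥ 24` (at `x = log q`: `log₄ q ≥ 0`). [folklore] -/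
private theorem log_log_log_nonneg : 0 ≤ Real.log (Real.log (Real.log x)) :=
  Real.log_nonneg (one_le_log_log hx)

/-- `4 log x ≤ x` for `x ≥ 24`. [folklore] -/
private theorem four_mul_log_le : 4 * Real.log x ≤ x := by
  have hx0 : 0 < x := by linarith
  have hy : (6 : ℝ) ≤ x / 4 := by linarith
  have hq := Real.quadratic_le_exp_of_nonneg (show (0 : ℝ) ≤ x / 4 by linarith)
  have hsq : 3 * (x / 4) ≤ (x / 4) ^ 2 / 2 := by nlinarith
  have hexp : x ≤ Real.exp (x / 4) := by nlinarith
  have := (Real.log_le_iff_le_exp hx0).mpr hexp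
  linarith

end Profile

section ProfileAtLevel

variable {q : ℕ} (hq : (24 : ℝ) ≤ Real.log q)
include hq

/-- `v₀(q) ≥ 1` once `log q ≥ 24`. [cite: GranvilleSoundararajan2006ExtremeValues, §7 Theorem 3 (ii) p.6] -/
theorem one_le_valueProfile : 1 ≤ valueProfile q := by
  unfold valueProfile
  have h1 := one_le_log hq
  have h2 := one_le_log_log hq
  have hγ := exp_gamma_bounds.1
  nlinarith

/-- `v₀(q) > 0` once `log q ≥ 24`. [cite: GranvilleSoundararajan2006ExtremeValues, §7 Theorem 3 (ii) p.6] -/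
theorem valueProfile_pos : 0 < valueProfile q := lt_of_lt_of_le one_pos (one_le_valueProfile hq)

/-- `v₀(q) ≤ log q` once `log q ≥ 24` (row 11 on the profile). [cite: MontgomeryVaughan2007, §4.3] -/
theorem valueProfile_le_log : valueProfile q ≤ Real.log q := by
  unfold valueProfile
  set x := Real.log (q : ℝ) with hxdef
  have hx0 : 0 < x := by linarith
  have hlx : 0 < Real.log x := by linarith [one_le_log hq]
  have h1 : Real.log (Real.log x) ≤ Real.log x - 1 := Real.log_le_sub_one_of_pos hlx
  have h2 : Real.log x ≤ x / 4 := by linarith [four_mul_log_le hq]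
  have hγ := exp_gamma_bounds
  have hsum : 0 ≤ Real.log x + Real.log (Real.log x) := by linarith [one_le_log_log hq]
  calc Real.exp Real.eulerMascheroniConstant * (Real.log x + Real.log (Real.log x))
      ≤ 2 * (Real.log x + Real.log (Real.log x)) := by nlinarith
    _ ≤ x := by linarith

/-- The printed level at `C = 0` is below the profile: `e^γ(log₂q + log₃q − log₄q − log A) ≤ v₀(q)` for `log q ≥ 24` and
`A ≥ 1` (`log₄ q ≥ 0`, `log A ≥ 0`). [cite: GranvilleSoundararajan2006ExtremeValues, §7 Theorem 3 (ii) p.6] -/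
theorem largeValueLevel_le_valueProfile {A : ℝ} (hA : 1 ≤ A) :
    GranvilleSoundararajan2006.largeValueLevel 0 A q ≤ valueProfile q := by
  unfold GranvilleSoundararajan2006.largeValueLevel valueProfile
  have h4 : 0 ≤ Real.log (Real.log (Real.log (Real.log (q : ℝ)))) := log_log_log_nonneg hq
  have h3 : 0 ≤ Real.log (Real.log (Real.log (q : ℝ))) := by linarith [one_le_log_log hq]
  have hA' : 0 ≤ Real.log A := Real.log_nonneg hA
  have hγ := exp_gamma_bounds.1
  nlinarith

end ProfileAtLevel

/-! ## 6. The value rows of `Menu` on `W⁺` -/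

section ValueRows

variable {D : ℕ} {χ : DirichletCharacter ℂ D}

variable (hL : (43250 : ℝ) ≤ Real.log D)
include hL

/-- **(A) on `W⁺`**: the slot `(D, χ)` is induced, value `λ(D) < (log D)⁻²⁰²²`. [cite: Zhang2022LandauSiegel, §2 Assumption (A)] -/
theorem worldPlus_assumptionA : (worldPlus D χ).LOne D χ < 1 / Real.log D ^ 2022 := by
  rw [worldPlus_LOne, if_pos isExcSlot_self]
  exact lam_lt_cap (log_pos_of_hL hL)

/-- **Row dhE-09 on `W⁺`**: a real zero in BGTZ's window is `β₁(D)` on an induced slot, where the value is `λ(D)` as on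
`W`. [cite: BenliGoelTwissZaman2025, Lemma 2.9] -/
theorem worldPlus_row09 : ∀ (q : ℕ) [NeZero q], 400000 < q → ∀ χ₁ : DirichletCharacter ℂ q, χ₁.IsQuadratic →
    χ₁ ≠ 1 → ∀ β₁ : ℝ, 1 - 1 / (10 * Real.log q) < β₁ → β₁ < 1 → (worldPlus D χ).IsZero q χ₁ β₁ →
      0.72 * (1 - β₁) ≤ (worldPlus D χ).LOne q χ₁ ∧ (worldPlus D χ).LOne q χ₁ ≤ 0.18 * Real.log q ^ 2 * (1 - β₁) := by
  intro q _ hq χ₁ hquad hne β₁ hlo hhi hz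
  have hz' : (world D χ).IsZero q χ₁ β₁ := hz
  obtain ⟨hs, rfl⟩ := real_zero_gt_half hL hz' (half_lt_of_window (by omega) hlo)
  have h := world_row09 (χ := χ) hL q hq χ₁ hquad hne (betaExc D) hlo hhi hz'
  rw [world_LOne, if_pos hs] at h
  rw [worldPlus_LOne, if_pos hs]
  exact h

/-- **Row dhE-11 on `W⁺`** (`LOne ≤ log q`, `ψ ≠ χ₀`): `λ ≤ 1 < log 3 ≤ log q`, `v₀(q) ≤ log q` (`log q ≥ 24`), `1 < log q`.
[cite: MontgomeryVaughan2007, §4.3] -/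
theorem worldPlus_row11 : ∀ (q : ℕ) [NeZero q] (ψ : DirichletCharacter ℂ q), ψ ≠ 1 →
    (worldPlus D χ).LOne q ψ ≤ Real.log q := by
  intro q _ ψ hne
  have h1 : (world D χ).LOne q ψ ≤ Real.log q := world_row11 hL q ψ hne
  rw [world_LOne] at h1
  rw [worldPlus_LOne]
  by_cases hs : IsExcSlot D χ q ψ
  · rw [if_pos hs] at h1 ⊢; exact h1
  · rw [if_neg hs] at h1 ⊢
    by_cases hp : ψ ≠ 1 ∧ (24 : ℝ) ≤ Real.log q
    · rw [if_pos hp]; exact valueProfile_le_log hp.2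
    · rw [if_neg hp]; exact h1

/-- **Row dhE-12 on `W⁺`** (the exceptional-zero package at `(D, χ)`): as on `W` — same zeros, and the slot `(D, χ)` is
induced, value `λ(D)`. [cite: Zhang2022LandauSiegel, Lemma 5.5] [cite: BenliGoelTwissZaman2025, Lemma 2.9] -/
theorem worldPlus_row12 (hquad : χ.IsQuadratic) :
    (worldPlus D χ).LOne D χ < 1 / Real.log D ^ 2022 → 400000 < D →
    ∃ β₁ : ℝ, 1 - 1 / (10 * Real.log D) < β₁ ∧ β₁ < 1 ∧ (worldPlus D χ).mult D χ β₁ = 1 ∧ χ ^ 2 = 1 ∧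
      (∀ (ψ : DirichletCharacter ℂ D) (β : ℝ), 1 - 1 / (10 * Real.log D) < β → β < 1 →
          (worldPlus D χ).IsZero D ψ β → ψ = χ ∧ β = β₁) ∧
      0.72 * (1 - β₁) ≤ (worldPlus D χ).LOne D χ ∧ 1 - β₁ < 25 / 18 / Real.log D ^ 2022 := by
  intro _ hD
  have hA : (world D χ).LOne D χ < 1 / Real.log D ^ 2022 := by
    rw [world_LOne, if_pos isExcSlot_self]; exact lam_lt_cap (log_pos_of_hL hL)
  obtain ⟨β₁, h1, h2, h3, h4, h5, h6, h7⟩ := world_row12 hL hquad hA hD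
  refine ⟨β₁, h1, h2, h3, h4, fun ψ β hlo hhi hz => h5 ψ β hlo hhi hz, ?_, h7⟩
  rw [world_LOne, if_pos isExcSlot_self] at h6
  rw [worldPlus_LOne, if_pos isExcSlot_self]
  exact h6

/-- **Row dhE-15 on `W⁺`** (the `0.69/√q` floor for real primitive `ψ`, `q ≥ 3`): induced slots as on `W`; `v₀(q) ≥ 1`;
`1 ≥ 0.69/√q`. [cite: MontgomeryVaughan2007, §4.3] -/
theorem worldPlus_row15 : ∀ (q : ℕ) [NeZero q], 3 ≤ q → ∀ ψ : DirichletCharacter ℂ q, ψ.IsPrimitive →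
    ψ.IsQuadratic → (69 / 100) / Real.sqrt q ≤ (worldPlus D χ).LOne q ψ := by
  intro q _ hq ψ hprim hquad
  have h1 : (69 / 100) / Real.sqrt q ≤ (world D χ).LOne q ψ := world_row15 hL q hq ψ hprim hquad
  rw [world_LOne] at h1
  rw [worldPlus_LOne]
  by_cases hs : IsExcSlot D χ q ψ
  · rw [if_pos hs] at h1 ⊢; exact h1
  · rw [if_neg hs] at h1 ⊢
    by_cases hp : ψ ≠ 1 ∧ (24 : ℝ) ≤ Real.log q
    · rw [if_pos hp]; exact le_trans h1 (one_le_valueProfile hp.2)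
    · rw [if_neg hp]; exact h1

/-- **Row dhE-19 on `W⁺` (LLS 2015 under GRH): INERT** — the GRH hypothesis read over `W⁺` fails at the zero `β₁(D)`
of the slot `(D, χ)` (same zeros as `W`). [cite: LamzouriLiSoundararajan2015, Theorem 1.5 p. 2393] -/
theorem worldPlus_row19 :
    (∀ (q : ℕ) (ψ : DirichletCharacter ℂ q) (ρ : ℂ), (worldPlus D χ).IsZero q ψ ρ → ρ.re = 1 / 2) →
    ∀ (q : ℕ) [NeZero q] (ψ : DirichletCharacter ℂ q), ψ.IsPrimitive → (10 : ℝ) ^ 10 ≤ (q : ℝ) →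
      (worldPlus D χ).LOne q ψ ≤
          2 * Real.exp Real.eulerMascheroniConstant * LamzouriLiSoundararajan2015.upperBracket q ∧
        1 / (worldPlus D χ).LOne q ψ ≤
          12 * Real.exp Real.eulerMascheroniConstant / Real.pi ^ 2 * LamzouriLiSoundararajan2015.lowerBracket q := by
  intro hGRH
  exfalso
  have hz : (worldPlus D χ).IsZero D χ ((betaExc D : ℝ) : ℂ) := by
    show 0 < (world D χ).mult D χ ((betaExc D : ℝ) : ℂ)
    rw [mult_self_betaExc hL]; exact Nat.one_pos
  have h := hGRH D χ _ hz
  rw [Complex.ofReal_re] at h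
  linarith [half_lt_betaExc hL]

/-- **Row S3 on `W⁺`**: `LOne > 0` off `χ₀`; `LOne(ψ̄) = LOne(ψ)` (induced slots and the profile predicate are stable under
`ψ ↦ ψ⁻¹`); `Lhalf ≥ 0`. [cite: MontgomeryVaughan2007, §4.3] -/
theorem worldPlus_rowS3 (hquad : χ.IsQuadratic) : ∀ (q : ℕ) [NeZero q] (ψ : DirichletCharacter ℂ q),
    (ψ ≠ 1 → 0 < (worldPlus D χ).LOne q ψ) ∧ (worldPlus D χ).LOne q ψ⁻¹ = (worldPlus D χ).LOne q ψ ∧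
      ∀ t : ℝ, 0 ≤ (worldPlus D χ).Lhalf q ψ t := by
  intro q _ ψ
  refine ⟨fun _ => ?_, ?_, fun t => ?_⟩
  · rw [worldPlus_LOne]
    by_cases hs : IsExcSlot D χ q ψ
    · rw [if_pos hs]; exact lam_pos_of_hL hL
    · rw [if_neg hs]
      by_cases hp : ψ ≠ 1 ∧ (24 : ℝ) ≤ Real.log q
      · rw [if_pos hp]; exact valueProfile_pos hp.2
      · rw [if_neg hp]; norm_num
  · rw [worldPlus_LOne, worldPlus_LOne]
    have hinv1 : (ψ⁻¹ ≠ 1) ↔ (ψ ≠ 1) := not_congr inv_eq_one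
    by_cases hs : IsExcSlot D χ q ψ
    · rw [if_pos hs, if_pos ((isExcSlot_inv_iff hquad).mpr hs)]
    · rw [if_neg hs, if_neg (fun h => hs ((isExcSlot_inv_iff hquad).mp h))]
      by_cases hp : ψ ≠ 1 ∧ (24 : ℝ) ≤ Real.log q
      · rw [if_pos hp, if_pos ⟨hinv1.mpr hp.1, hp.2⟩]
      · have hp' : ¬ (ψ⁻¹ ≠ 1 ∧ (24 : ℝ) ≤ Real.log q) := fun h => hp ⟨hinv1.mp h.1, h.2⟩
        rw [if_neg hp, if_neg hp']
  · show (0 : ℝ) ≤ (world D χ).Lhalf q ψ t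
    rw [world_Lhalf]; norm_num

end ValueRows

/-! ## 7. Row dhE-18 (ii) on `W⁺` -/

section Row18

variable {D : ℕ} {χ : DirichletCharacter ℂ D}

/-- The dhE-18 (ii) threshold function of `W⁺`: `q₀(A) := ⌈exp(max A 24)⌉₊`.
[cite: GranvilleSoundararajan2006ExtremeValues, §7 Theorem 3 (ii) p.6] -/
def row18Threshold (A : ℝ) : ℕ := ⌈Real.exp (max A 24)⌉₊

/-- `q ≥ q₀(A)` gives `log q ≥ max A 24`. [cite: GranvilleSoundararajan2006ExtremeValues, §7 Theorem 3 (ii) p.6] -/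
theorem max_le_log_of_row18Threshold_le {A : ℝ} {q : ℕ} (h : row18Threshold A ≤ q) : max A 24 ≤ Real.log q := by
  have h1 : Real.exp (max A 24) ≤ (q : ℝ) :=
    le_trans (Nat.le_ceil _) (by exact_mod_cast h)
  rw [Real.le_log_iff_exp_le (lt_of_lt_of_le (Real.exp_pos _) h1)]
  exact h1

/-- At most one induced slot per level. [cite: MontgomeryVaughan2007, §9.1] -/
theorem card_filter_isExcSlot_le_one (q : ℕ) :
    (Finset.univ.filter fun ψ : DirichletCharacter ℂ q => IsExcSlot D χ q ψ).card ≤ 1 := by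
  refine Finset.card_le_one.mpr fun ψ hψ ψ' hψ' => ?_
  rw [Finset.mem_filter] at hψ hψ'
  exact hψ.2.eq_of_eq hψ'.2

/-- Counting on `W⁺`: at a level with `log q ≥ 24`, every non-principal non-induced `ψ` has value `v₀(q)`, so for a level
`V ≤ v₀(q)` the count is at least `#{ψ mod q} − 2`. [cite: GranvilleSoundararajan2006ExtremeValues, §7 Theorem 3 (ii) p.6] -/
theorem card_sub_two_le_largeValueCount {q : ℕ} [NeZero q] (hq : (24 : ℝ) ≤ Real.log q) {V : ℝ}
    (hV : V ≤ valueProfile q) :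
    Fintype.card (DirichletCharacter ℂ q) ≤ (worldPlus D χ).largeValueCount q V + 2 := by
  classical
  unfold ZeroWorld.largeValueCount
  set P : DirichletCharacter ℂ q → Prop := fun ψ => ψ ≠ 1 ∧ V ≤ (worldPlus D χ).LOne q ψ with hP
  set S := (Finset.univ.filter fun ψ : DirichletCharacter ℂ q => P ψ) with hS
  set E := (Finset.univ.filter fun ψ : DirichletCharacter ℂ q => IsExcSlot D χ q ψ) with hE
  -- the complement of `S` sits inside `{χ₀} ∪ E`
  have hcompl : (Finset.univ.filter fun ψ : DirichletCharacter ℂ q => ¬ P ψ) ⊆ {1} ∪ E := by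
    intro ψ hψ
    rw [Finset.mem_filter] at hψ
    rw [Finset.mem_union, Finset.mem_singleton, hE, Finset.mem_filter]
    by_cases h1 : ψ = 1
    · exact Or.inl h1
    by_cases h2 : IsExcSlot D χ q ψ
    · exact Or.inr ⟨Finset.mem_univ _, h2⟩
    exfalso
    apply hψ.2
    refine ⟨h1, ?_⟩
    show V ≤ (worldPlus D χ).LOne q ψ
    rw [worldPlus_LOne, if_neg h2, if_pos ⟨h1, hq⟩]
    exact hV
  have hsplit : (Finset.univ : Finset (DirichletCharacter ℂ q)).card =
      S.card + (Finset.univ.filter fun ψ : DirichletCharacter ℂ q => ¬ P ψ).card := by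
    rw [hS]; exact (Finset.card_filter_add_card_filter_not _).symm
  have hc2 : (Finset.univ.filter fun ψ : DirichletCharacter ℂ q => ¬ P ψ).card ≤ 2 := by
    calc (Finset.univ.filter fun ψ : DirichletCharacter ℂ q => ¬ P ψ).card ≤ (({1} : Finset _) ∪ E).card :=
          Finset.card_le_card hcompl
      _ ≤ ({1} : Finset (DirichletCharacter ℂ q)).card + E.card := Finset.card_union_le _ _
      _ ≤ 1 + 1 := Nat.add_le_add (by simp) (card_filter_isExcSlot_le_one q)
  rw [← Finset.card_univ, hsplit]
  omega

/-- `q^{1−1/A} ≤ q − 3` for `A ≥ 10` and `q ≥ e^A`. [cite: GranvilleSoundararajan2006ExtremeValues, §7 Theorem 3 (ii) p.6] -/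
theorem rpow_le_sub_three {A : ℝ} (hA : 10 ≤ A) {q : ℕ} (hAq : A ≤ Real.log q) (h24 : (24 : ℝ) ≤ Real.log q) :
    (q : ℝ) ^ (1 - 1 / A) ≤ (q : ℝ) - 3 := by
  have hA0 : 0 < A := by linarith
  have hq0 : (0 : ℝ) < q := by
    by_contra h
    push Not at h
    have : (q : ℝ) = 0 := le_antisymm h (Nat.cast_nonneg q)
    rw [this, Real.log_zero] at h24; linarith
  have hexpA : Real.exp A ≤ (q : ℝ) := by rwa [← Real.le_log_iff_exp_le hq0]
  have hq6 : (6 : ℝ) ≤ q := by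
    have h1 : Real.exp 10 ≤ Real.exp A := Real.exp_le_exp.mpr hA
    linarith [Real.add_one_le_exp (10 : ℝ)]
  -- `q^{1/A} ≥ e ≥ 2`
  have hroot : Real.exp 1 ≤ (q : ℝ) ^ (1 / A) := by
    have h1 : Real.exp A ^ (1 / A) ≤ (q : ℝ) ^ (1 / A) :=
      Real.rpow_le_rpow (Real.exp_pos A).le hexpA (by positivity)
    have h2 : Real.exp A ^ (1 / A) = Real.exp 1 := by
      rw [← Real.exp_mul]; congr 1; field_simp
    rw [h2] at h1; exact h1
  have hroot2 : (2 : ℝ) ≤ (q : ℝ) ^ (1 / A) := by linarith [Real.exp_one_gt_d9]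
  have hrootpos : 0 < (q : ℝ) ^ (1 / A) := by positivity
  rw [Real.rpow_sub hq0, Real.rpow_one, div_le_iff₀ hrootpos]
  nlinarith

/-- **Row dhE-18 (ii) on `W⁺`** with `C = 0`, `q₀ = row18Threshold`. [cite: GranvilleSoundararajan2006ExtremeValues, §7 Theorem 3 (ii) p.6] -/
theorem worldPlus_row18ii : ∀ A : ℝ, 10 ≤ A → ∀ (q : ℕ) [NeZero q], q.Prime → row18Threshold A ≤ q →
    (q : ℝ) ^ (1 - 1 / A) ≤
      ((worldPlus D χ).largeValueCount q (GranvilleSoundararajan2006.largeValueLevel 0 A q) : ℝ) := by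
  intro A hA q _ hprime hq
  have hmax := max_le_log_of_row18Threshold_le hq
  have h24 : (24 : ℝ) ≤ Real.log q := le_trans (le_max_right _ _) hmax
  have hAq : A ≤ Real.log q := le_trans (le_max_left _ _) hmax
  have hcount := card_sub_two_le_largeValueCount (D := D) (χ := χ) h24
    (largeValueLevel_le_valueProfile h24 (by linarith : (1 : ℝ) ≤ A))
  have hcard : Fintype.card (DirichletCharacter ℂ q) = q - 1 := by
    rw [← Nat.card_eq_fintype_card, DirichletCharacter.card_eq_totient_of_hasEnoughRootsOfUnity ℂ q,
      Nat.totient_prime hprime]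
  have hq2 : 2 ≤ q := hprime.two_le
  have hnat : q - 3 ≤ (worldPlus D χ).largeValueCount q (GranvilleSoundararajan2006.largeValueLevel 0 A q) := by
    rw [hcard] at hcount; omega
  have hreal : ((q : ℝ) - 3) ≤
      ((worldPlus D χ).largeValueCount q (GranvilleSoundararajan2006.largeValueLevel 0 A q) : ℝ) := by
    have h3q : 3 ≤ q := by
      by_contra hlt
      have hq2' : (q : ℝ) ≤ 2 := by exact_mod_cast (by omega : q ≤ 2)
      have : Real.log (q : ℝ) ≤ Real.log 2 := Real.log_le_log (by exact_mod_cast (by omega : 0 < q)) hq2'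
      linarith [Real.log_two_lt_d9]
    have := (Nat.cast_le (α := ℝ)).mpr hnat
    rw [Nat.cast_sub h3q] at this
    exact_mod_cast this
  exact le_trans (rpow_le_sub_three hA hAq h24) hreal

end Row18

/-! ## 8. Transfer of the zero / prime-data menus from `W` to `W⁺`, and the theorem -/

section Transfer

variable {D : ℕ} {χ : DirichletCharacter ℂ D}

/-- `Menu` on `W⁺`: zero rows verbatim from `W` (same `mult`), value rows from §6.
[cite: Zhang2022LandauSiegel, §2 Assumption (A)] -/
theorem menu_worldPlus [NeZero D] (hquad : χ.IsQuadratic) (hL : (43250 : ℝ) ≤ Real.log D)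
    (hM : (world D χ).Menu D χ) : (worldPlus D χ).Menu D χ where
  assumptionA := worldPlus_assumptionA hL
  row01 := hM.row01
  row02 := hM.row02
  row03 := hM.row03
  row04 := hM.row04
  row05 := hM.row05
  row06 := hM.row06
  row08 := hM.row08
  row09 := worldPlus_row09 hL
  row10 := hM.row10
  row11 := worldPlus_row11 hL
  row12 := worldPlus_row12 hL hquad
  row13 := hM.row13
  row15 := worldPlus_row15 hL
  row19 := worldPlus_row19 hL
  rowS1 := hM.rowS1
  rowS2 := hM.rowS2
  rowS3 := worldPlus_rowS3 hL hquad
  rowS4 := hM.rowS4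

/-- `PrimeMenu` on `W⁺` verbatim from `W` (same `psi`, same zeros). [cite: ThornerZaman2024PNTAP, Theorem 1 p.3] -/
theorem primeMenu_worldPlus (hM : PrimeMenu (world D χ) (primeWorld D χ)) :
    PrimeMenu (worldPlus D χ) (primeWorld D χ) where
  rowP1 := hM.rowP1
  rowP2 := hM.rowP2
  rowP3 := hM.rowP3
  rowP4 := hM.rowP4
  rowP5 := hM.rowP5
  rowP6 := hM.rowP6
  rowS5 := hM.rowS5

/-- `MenuInformal` on `W⁺` verbatim from `W` (same zeros). [cite: ThornerZaman2024PNTAP, Theorem 7 p.4] -/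
theorem menuInformal_worldPlus {C₇ : ℝ} {c₀ C₂₈ C₁₂ : ℝ → ℝ} {R₀ : ℝ}
    (hM : (world D χ).MenuInformal C₇ c₀ C₂₈ C₁₂ R₀) : (worldPlus D χ).MenuInformal C₇ c₀ C₂₈ C₁₂ R₀ where
  row07 := hM.row07
  row28 := hM.row28
  rowCor12 := hM.rowCor12
  rowKadiri := hM.rowKadiri

/-- `MenuInformalCritLine` on `W⁺` verbatim from `W` (same zeros). [cite: ConreyIwaniecSoundararajan2011CriticalZeros, Theorem 1] -/
theorem menuInformalCritLine_worldPlus {Q₀ Q₁ : (ℝ → ℝ) → ℝ → ℝ} {T₀ : (ℝ → ℝ) → ℝ}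
    (hM : (world D χ).MenuInformalCritLine Q₀ Q₁ T₀) : (worldPlus D χ).MenuInformalCritLine Q₀ Q₁ T₀ where
  rowCIS1 := hM.rowCIS1
  rowSono := hM.rowSono
  rowWu := hM.rowWu

end Transfer

/-- **E-18d DISCHARGED: `MenuInformalLOneConsistent` holds** — ONE world, `W⁺(D, χ)`, meets every kernel-typed row of
`M_typed ∪ M_primes ∪ M_informal` including dhE-18 (ii) (Granville–Soundararajan 2006 §7 Thm 3 (ii), verbatim), for every
`log D ≥ 43 250`, with all existential constants chosen once (`C = 0`, `q₀ = row18Threshold`, and the constants of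
`menuInformalConsistent_holds` / `menuInformalCritLineConsistent_holds`). A COMPANION outside the word's scope (term (i)).
«The programme SEARCHES and TYPES; no claim about Landau–Siegel zeros, Theorems 1–2 of arXiv:2211.02515 or a repaired
Margin232 until a kernel theorem says so.» [cite: Zhang2022LandauSiegel, §2 Assumption (A)] -/
theorem menuInformalLOneConsistent_holds : MenuInformalLOneConsistent := by
  obtain ⟨C₇, hC₇, c₀, hc₀, C₂₈, hC₂₈, C₁₂, R₀, hR₀, hInf⟩ := menuInformalConsistent_holds
  obtain ⟨Q₀, Q₁, T₀, hCrit⟩ := menuInformalCritLineConsistent_holds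
  refine ⟨0, row18Threshold, C₇, hC₇, c₀, hc₀, C₂₈, hC₂₈, C₁₂, R₀, hR₀, Q₀, Q₁, T₀, ?_⟩
  intro D _ χ hprim hquad hne hL
  exact ⟨menu_worldPlus hquad hL (menuConsistent_holds D χ hprim hquad hne hL),
    primeMenu_worldPlus (menuConsistentPrimes_holds D χ hprim hquad hne hL),
    menuInformal_worldPlus (hInf D χ hprim hquad hne hL),
    menuInformalCritLine_worldPlus (hCrit D χ hprim hquad hne hL),
    ⟨worldPlus_row18ii⟩⟩

/-- The referee's C2 probe (REF-E §0b): the proved type is the definition BY NAME. [cite: Zhang2022LandauSiegel, §2 Assumption (A)] -/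
example : Literature.NumberTheory.LFunctions.Zhang2022.DH.MenuInformalLOneConsistent := menuInformalLOneConsistent_holds

end Literature.NumberTheory.LFunctions.Zhang2022.DH

end
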